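import Summits.BirchSwinnertonDyer.BirchSwinnertonDyer.Theorems.ManinLocalTwoThreeKummerCubeQExpansionPrinciple
import HarnessLib

/-!
# The `q`-expansion identity principle for `n`-th powers (the `p = 2` twin S2₂ of leaf S2, and the general case)
# (route `ManinLocalTwoThree`, cruxes C2 `ManinOddAtFour` stmt-BirchSwinnertonDyer-22967 / C3 stmt-…-22968; cell bsd-f2-manin, p2 gen 16)

Sequel of `Theorems/ManinLocalTwoThreeKummerCubeQExpansionPrinciple.lean` (S2 = the cube case, p719763).  For modular forms
`F, G ∈ M_k(Γ₀(M))` and every `n`: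

* `hasSum_coeff_qExpansion_pow` — the `q`-series of `F̂ⁿ` (the `n`-th power of the `q`-expansion at `∞`, width `1`) sums to `F(τ)ⁿ`;
* `qExpansion_pow_identity_principle` — if `F̂ⁿ = Θ·Ĝⁿ` in `ℂ⟦q⟧` and `Θ` sums to `θ(τ)` for `Im τ > B`, then `F(τ)ⁿ = θ(τ)·G(τ)ⁿ` there;
* `qExpansion_sq_identity_principle` — the case `n = 2` (S2₂, for the planners' `p = 2` Kummer-square line, C2 v21
  `stub_cuspidalKummerOddExponentOnCore`), by name.
Ingredients: `hasSum_qExpansion_modularForm_gamma0`, Cauchy products of absolutely convergent `q`-series (`hasSum_coeff_mul_pow_mul`).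
HONEST FRAMING: routine `q`-expansion analysis; nothing about BSD or Manin's conjecture is proved; C2/C3 remain OPEN.
[cite: DiamondShurman2005, §1.1–1.2 (q-expansions at ∞; shape)]
-/

set_option autoImplicit false
-- lint-debt: the directory name repeats the summit name (sibling precedent `ManinLocalTwoThreeKummerCubeQExpansionPrinciple.lean`)
set_option linter.dupNamespace false

noncomputable section

open Complex PowerSeries
open scoped UpperHalfPlane MatrixGroups ModularForm
open CongruenceSubgroup

namespace Summit.BirchSwinnertonDyer.BirchSwinnertonDyer.Theorems.ManinLocalTwoThree.KummerCubeSigmaLeaves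

/-- The `q`-series of `F̂ⁿ` sums to `F(τ)ⁿ` (`n`-fold Cauchy product of the absolutely convergent `q`-expansion).
[cite: DiamondShurman2005, §1.1 (shape)] -/
theorem hasSum_coeff_qExpansion_pow {M : ℕ} {k : ℤ} (F : ModularForm (Gamma0 M) k) (τ : ℍ) (n : ℕ) :
    HasSum (fun m : ℕ ↦ coeff m (UpperHalfPlane.qExpansion 1 ⇑F ^ n) * Function.Periodic.qParam 1 (τ : ℂ) ^ m)
      (F τ ^ n) := by
  induction n with
  | zero =>
    simp only [pow_zero, coeff_one]
    have h : (fun m : ℕ ↦ (if m = 0 then (1 : ℂ) else 0) * Function.Periodic.qParam 1 (τ : ℂ) ^ m) =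
        fun m : ℕ ↦ if m = 0 then (1 : ℂ) else 0 := by
      funext m
      split_ifs with hm
      · simp [hm]
      · simp
    rw [h]
    exact hasSum_ite_eq 0 1
  | succ n ih =>
    rw [pow_succ, pow_succ]
    exact hasSum_coeff_mul_pow_mul ih (hasSum_qExpansion_modularForm_gamma0 F τ)

/-- **`q`-expansion identity principle for `n`-th powers**: `F̂ⁿ = Θ·Ĝⁿ` in `ℂ⟦q⟧` with `Θ` summing to `θ(τ)` for `Im τ > B` gives
`F(τ)ⁿ = θ(τ)·G(τ)ⁿ` for `Im τ > B`. [cite: DiamondShurman2005, §1.1–1.2 (shape)] -/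
theorem qExpansion_pow_identity_principle {M : ℕ} [NeZero M] {k : ℤ} (F G : ModularForm (Gamma0 M) k) (n : ℕ)
    (Θ : PowerSeries ℂ) (θ : ℍ → ℂ) (B : ℝ)
    (hΘ : ∀ τ : ℍ, B < τ.im → HasSum (fun m : ℕ ↦ coeff m Θ * Function.Periodic.qParam 1 (τ : ℂ) ^ m) (θ τ))
    (hPS : UpperHalfPlane.qExpansion 1 ⇑F ^ n = Θ * UpperHalfPlane.qExpansion 1 ⇑G ^ n) :
    ∀ τ : ℍ, B < τ.im → F τ ^ n = θ τ * G τ ^ n := by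
  intro τ hτ
  have hFn := hasSum_coeff_qExpansion_pow F τ n
  have hΘG := hasSum_coeff_mul_pow_mul (hΘ τ hτ) (hasSum_coeff_qExpansion_pow G τ n)
  rw [← hPS] at hΘG
  exact hFn.unique hΘG

/-- **S2₂ — the `q`-expansion identity principle for SQUARES** (`n = 2`): `F̂² = Θ·Ĝ²`, `Θ ↝ θ` for `Im τ > B` ⟹ `F² = θ·G²` there.
[cite: DiamondShurman2005, §1.1–1.2 (shape)] -/
theorem qExpansion_sq_identity_principle :
    ∀ (M : ℕ) [NeZero M] (k : ℤ) (F G : ModularForm (Gamma0 M) k) (Θ : PowerSeries ℂ) (θ : ℍ → ℂ) (B : ℝ),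
      (∀ τ : ℍ, B < τ.im → HasSum (fun n : ℕ ↦ coeff n Θ * Function.Periodic.qParam 1 (τ : ℂ) ^ n) (θ τ)) →
      UpperHalfPlane.qExpansion 1 ⇑F ^ 2 = Θ * UpperHalfPlane.qExpansion 1 ⇑G ^ 2 →
      ∀ τ : ℍ, B < τ.im → F τ ^ 2 = θ τ * G τ ^ 2 :=
  fun _M _ _k F G Θ θ B hΘ hPS ↦ qExpansion_pow_identity_principle F G 2 Θ θ B hΘ hPS

end Summit.BirchSwinnertonDyer.BirchSwinnertonDyer.Theorems.ManinLocalTwoThree.KummerCubeSigmaLeaves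

end
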